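import Summits.HubbardSuperconductivity.HubbardSuperconductivity.Theorems.BalabanIRBirGroundStateAverageLROOfEveryCouplingLRO
import Summits.HubbardSuperconductivity.HubbardSuperconductivity.Theorems.BalabanIRBirGroundStateAverageLRO
import Summits.HubbardSuperconductivity.HubbardSuperconductivity.Theorems.BalabanIRBirEveryGroundStateThermalChordCore
import Literature.MathematicalPhysics.QuantumLattice.GriffithsLemmaGroundStates
import Mathlib.Analysis.Convex.Continuous
import HarnessLib

/-!
# Route BalabanIR — target `BirGroundStateAverageLRO`: pointwise floor + uniformly bounded ground multiplicity ⇒ the target AS TYPED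

Helper file `--supports stmt-HubbardSuperconductivity-2079`
(`Summit.HubbardSuperconductivity.HubbardSuperconductivity.Theses.BalabanIR.BirGroundStateAverageLRO`,
the ground-state-AVERAGE `d_{x²-y²}` pair-field bound `c·L⁴·Re tr P ≤ Re tr (P Δ_d† Δ_d)` with ONE
constant `c` at EVERY coupling of an open window).

The uniformisation bridge (`…WindowUniformisationCountable.lean`, `…OfEveryCouplingLRO.lean`,
prover seat 2) turns a POINTWISE floor (each coupling with its own constant) into one constant on
a sub-window at every coupling OUTSIDE closed nowhere dense countable sets `C_L` (level
crossings of the finite-volume ground multiplets); and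
`Theorems/BirGroundStateAverageLRO/Negative/UniformisationTight.lean` (lead c21) shows the
exceptional sets cannot be removed for general affine pencils — the obstruction there is a
ground multiplicity at the exceptional coupling that is UNBOUNDED in `L`. This file proves the
complementary positive statement: the exceptional sets disappear as soon as the ground
multiplicity is bounded uniformly on the window.

* `le_re_trace_groundProj_mul_of_mem_closure` — abstract: for an affine Hermitian pencil
  `A(u) = H + u • Y` preserving a sector `K ≠ ⊥` and `B ≥ 0`, if `c · Re tr P(u) ≤ Re tr (P(u) B)`
  at every `u` of a set `G` (`P(u)` the projection onto the sector ground multiplet), then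
  `c ≤ Re tr (P(u₀) B)` at every `u₀ ∈ closure G`: a good unit ground vector at `u ∈ G`
  (pigeonhole) has a convergent subsequence as `u → u₀`; its limit is a unit GROUND vector at
  `u₀` (the sector energy is concave hence continuous along the pencil, Griffiths) with
  `Re ⟨ψ, B ψ⟩ ≥ c`, and one such vector bounds the compressed trace of `B ≥ 0` from below.
  (Upper semicontinuity of the ground multiplet; Kato (1966) II-§5.1.)
* `dWaveAvg_uniform_of_pointwise_of_finrank_le` — Hubbard torus: pointwise floor on a window
  `(U₁, U₂)` AND `dim E₀(U, L) ≤ M` for all `U` in the window and all even `L ≥ L₁` ⇒ a sub-window,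
  ONE constant `c / max(M,1) > 0` and ONE `L₀` with the target's inner inequality at EVERY coupling
  of the sub-window (no exceptional set): off `C_L` this is the bridge; at `U ∈ C_L` the abstract
  lemma gives `c L⁴ ≤ Re tr (P Δ_d†Δ_d)` and `Re tr P = dim E₀ ≤ M`.
* `birGroundStateAverageLRO_of_pointwise_of_finrank_le`,
  `birGroundStateAverageLRO_of_forall_hasDWavePairFieldLROAt_of_finrank_le` — the target itself
  from (pointwise floor, resp. per-coupling summit-strength pair LRO `HasDWavePairFieldLROAt U δ`
  at every coupling of a window `0 < U₁ < U₂`, `δ ∈ (0,½)`) plus the uniform multiplicity bound.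

So, for the target as typed, "per-coupling engine + window uniformisation" needs exactly one
extra spectral input: a volume-uniform bound on the degeneracy of the sector ground multiplet on
the window (e.g. uniqueness of the `(N_L, S^z = 0)` ground state for even `L`, expected but not
known for the doped repulsive Hubbard torus). Folklore finite-dimensional statements; no named
facts, no definitions.
-/

noncomputable section

namespace Summit.HubbardSuperconductivity.HubbardSuperconductivity.Theorems

open Matrix Set Filter Topology
open Literature.MathematicalPhysics.QuantumLattice Literature.Probability.LatticeModels
open Literature.MathematicalPhysics.QuantumLattice.EigenvalueContinuation
open Literature.Computability.AlgebraicComplexity Literature.Barriers.HubbardSuperconductivity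
open Summit.HubbardSuperconductivity.HubbardSuperconductivity.Theses.BalabanIR
open scoped ComplexOrder

/-! ### Abstract: a trace floor on `G` passes to the closure of `G` -/

/-- **A ground-multiplet trace floor passes to limit couplings.** Let `A(u) = H + u • Y` be an
affine Hermitian pencil preserving a sector `K ≠ ⊥`, `E(u) = K ⊓ ker (A(u) - e(u))` its sector
ground multiplet (`e(u) = minEnergyOn (A u) K`), `P(u)` the orthogonal projection onto `E(u)`,
and `B ≥ 0`. If `c · Re tr P(u) ≤ Re tr (P(u) B)` for every `u ∈ G`, then
`c ≤ Re tr (P(u₀) B)` for every `u₀ ∈ closure G`. (Pigeonhole gives a unit `ψ_u ∈ E(u)` with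
`Re ⟨ψ_u, B ψ_u⟩ ≥ c`; along `u → u₀` a subsequence converges to a unit vector of `K` which is a
ground vector at `u₀` because `e` is continuous — concave along the pencil — and `Re ⟨ψ, B ψ⟩`
of one unit vector of `E(u₀)` is at most `Re tr (P(u₀) B)` for `B ≥ 0`.) Kato (1966) II-§5.1
(upper semicontinuity of eigenprojections). [folklore] -/
theorem le_re_trace_groundProj_mul_of_mem_closure {ι : Type*} [Fintype ι] [DecidableEq ι]
    {H Y B : Matrix ι ι ℂ} (hH : H.IsHermitian) (hY : Y.IsHermitian) (hB : B.PosSemidef)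
    (K : Submodule ℂ (ι → ℂ)) (hKH : ∀ v ∈ K, H *ᵥ v ∈ K) (hKY : ∀ v ∈ K, Y *ᵥ v ∈ K)
    (hK : K ≠ ⊥) {A : ℝ → Matrix ι ι ℂ} {E : ℝ → Submodule ℂ (ι → ℂ)} {P : ℝ → Matrix ι ι ℂ}
    (hA : ∀ u, A u = H + (u : ℂ) • Y)
    (hE : ∀ u, E u = K ⊓ Module.End.eigenspace (Matrix.toLin' (A u)) (((A u).minEnergyOn K : ℝ) : ℂ))
    (hP : ∀ u, P u = projMatrix ((E u).map
      ((WithLp.linearEquiv 2 ℂ (ι → ℂ)).symm : (ι → ℂ) →ₗ[ℂ] EuclideanSpace ℂ ι)))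
    {G : Set ℝ} {c u₀ : ℝ} (hu₀ : u₀ ∈ closure G)
    (hG : ∀ u ∈ G, c * (P u).trace.re ≤ (P u * B).trace.re) :
    c ≤ (P u₀ * B).trace.re := by
  classical
  have hAh : ∀ u, (A u).IsHermitian := fun u => by
    rw [hA]; exact isHermitian_add_ofReal_smul hH hY u
  have hAK : ∀ u, ∀ v ∈ K, A u *ᵥ v ∈ K := fun u v hv => by
    rw [hA, add_mulVec, smul_mulVec]
    exact K.add_mem (hKH v hv) (K.smul_mem _ (hKY v hv))
  have hEne : ∀ u, E u ≠ ⊥ := fun u => by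
    rw [hE]; exact inf_eigenspace_minEnergyOn_ne_bot (hAh u) K (hAK u) hK
  -- a sequence of couplings of `G` converging to `u₀`
  obtain ⟨u, huG, hu⟩ := mem_closure_iff_seq_limit.1 hu₀
  -- good unit ground vectors along the sequence (pigeonhole over an orthonormal frame)
  have hgood : ∀ n, ∃ ψ ∈ E (u n), star ψ ⬝ᵥ ψ = 1 ∧ c ≤ (star ψ ⬝ᵥ B *ᵥ ψ).re := fun n => by
    have h := hG (u n) (huG n)
    rw [hP] at h
    exact exists_unit_le_re_of_trace_projMatrix_map (E (u n)) (hEne _) B c h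
  choose ψ hψE hψ1 hψc using hgood
  have hψK : ∀ n, ψ n ∈ K := fun n => by
    have h := hψE n
    rw [hE] at h
    exact (Submodule.mem_inf.1 h).1
  -- compactness of the unit sphere of `K`: a convergent subsequence
  obtain ⟨φ, ⟨hφK, hφ1⟩, g, hg, hlim⟩ :=
    (isCompact_unitSphere_inter K).tendsto_subseq (x := ψ) fun n => ⟨hψK n, hψ1 n⟩
  -- the sector energy is continuous along the pencil (concave on `ℝ`)
  set e : ℝ → ℝ := fun s => (H + (s : ℂ) • Y).minEnergyOn K with he_def
  have he_cont : Continuous e :=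
    continuousOn_univ.1 ((concaveOn_minEnergyOn_pencil hH hY hK).continuousOn isOpen_univ)
  -- the eigen-equations along the sequence, and their limit
  have heig : ∀ n, H *ᵥ ψ n + ((u n : ℝ) : ℂ) • (Y *ᵥ ψ n) = ((e (u n) : ℝ) : ℂ) • ψ n := by
    intro n
    have h := hψE n
    rw [hE, mem_inf_eigenspace_toLin'_iff, hA, add_mulVec, smul_mulVec] at h
    exact h.2
  have hug : Tendsto (fun n => u (g n)) atTop (𝓝 u₀) := hu.comp hg.tendsto_atTop
  have hl1 : Tendsto (fun n => H *ᵥ ψ (g n) + ((u (g n) : ℝ) : ℂ) • (Y *ᵥ ψ (g n))) atTop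
      (𝓝 (H *ᵥ φ + ((u₀ : ℝ) : ℂ) • (Y *ᵥ φ))) := by
    have hu' : Tendsto (fun n => ((u (g n) : ℝ) : ℂ)) atTop (𝓝 ((u₀ : ℝ) : ℂ)) :=
      (Complex.continuous_ofReal.tendsto u₀).comp hug
    have hH' : Tendsto (fun n => H *ᵥ ψ (g n)) atTop (𝓝 (H *ᵥ φ)) :=
      ((Matrix.mulVecLin H).continuous_of_finiteDimensional.tendsto φ).comp hlim
    have hY' : Tendsto (fun n => Y *ᵥ ψ (g n)) atTop (𝓝 (Y *ᵥ φ)) :=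
      ((Matrix.mulVecLin Y).continuous_of_finiteDimensional.tendsto φ).comp hlim
    exact hH'.add (hu'.smul hY')
  have hl2 : Tendsto (fun n => ((e (u (g n)) : ℝ) : ℂ) • ψ (g n)) atTop
      (𝓝 (((e u₀ : ℝ) : ℂ) • φ)) := by
    have he' : Tendsto (fun n => ((e (u (g n)) : ℝ) : ℂ)) atTop (𝓝 ((e u₀ : ℝ) : ℂ)) :=
      (Complex.continuous_ofReal.tendsto _).comp ((he_cont.tendsto u₀).comp hug)
    exact he'.smul hlim
  have heq : H *ᵥ φ + ((u₀ : ℝ) : ℂ) • (Y *ᵥ φ) = ((e u₀ : ℝ) : ℂ) • φ :=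
    tendsto_nhds_unique (hl1.congr fun n => heig (g n)) hl2
  -- so the limit is a unit ground vector at `u₀` …
  have hφE : φ ∈ E u₀ := by
    rw [hE, mem_inf_eigenspace_toLin'_iff, hA, add_mulVec, smul_mulVec]
    exact ⟨hφK, heq⟩
  -- … with Rayleigh quotient `≥ c`
  have hray : c ≤ (star φ ⬝ᵥ B *ᵥ φ).re :=
    ge_of_tendsto (((continuous_energy B).tendsto φ).comp hlim)
      (Eventually.of_forall fun n => hψc (g n))
  -- one good unit vector of `E(u₀)` bounds the compressed trace of `B ≥ 0` from below
  rw [hP]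
  exact hray.trans (re_rayleigh_le_re_trace_projMatrix_mul hB (E u₀) hφE hφ1)

/-! ### The Hubbard torus: no exceptional couplings under a uniform multiplicity bound -/

section Torus

/-- **Pointwise floor + uniformly bounded ground multiplicity ⇒ ONE constant at EVERY coupling of
a sub-window.** If at every coupling `U` of a window `(U₁, U₂)` (`δ ≥ -1`) the average bound
holds eventually in even `L` with its own constant `c(U) > 0`, and the sector ground multiplet
`E₀ = szSector N_L 0 ⊓ ker (H_U - e₀)` has dimension `≤ M` for every coupling of the window and
every even `L ≥ L₁`, then there are `U₁ ≤ U₁' < U₂' ≤ U₂`, `c > 0` and `L₀` with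
`c · L⁴ · Re tr P ≤ Re tr (P Δ_d† Δ_d)` for ALL `U ∈ (U₁', U₂')` and all even `L ≥ L₀`
(`dWaveAvg_uniform_offCountable_of_pointwise` off the exceptional sets `C_L`;
`le_re_trace_groundProj_mul_of_mem_closure` at `U ∈ C_L`, which lies in the closure of
`(U₁', U₂') ∖ C_L` because `C_L` is closed and nowhere dense; then `Re tr P = dim E₀ ≤ M`).
[folklore] -/
theorem dWaveAvg_uniform_of_pointwise_of_finrank_le {δ U₁ U₂ : ℝ} (hδ : -1 ≤ δ) (hU : U₁ < U₂)
    (hpw : ∀ U ∈ Set.Ioo U₁ U₂, ∃ c : ℝ, 0 < c ∧ ∃ L₀ : ℕ, ∀ (L : ℕ) [NeZero L], L₀ ≤ L →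
      Even L →
        let N : ℕ := 2 * ⌊(1 - δ) * (L : ℝ) ^ 2 / 2⌋₊
        let H := hubbardTorus 2 L 1 U
        let S := szSector (Λ := FermionTorus 2 L) N 0
        let E₀ := S ⊓ Module.End.eigenspace (Matrix.toLin' H) ((H.minEnergyOn S : ℝ) : ℂ)
        let P := projMatrix (E₀.map (Fock.toEuclidean (ι := Orb (FermionTorus 2 L)) :
          Fock (Orb (FermionTorus 2 L)) →ₗ[ℂ] EuclideanSpace ℂ (Finset (Orb (FermionTorus 2 L)))))
        c * (L : ℝ) ^ 4 * P.trace.re ≤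
          (P * (Matrix.conjTranspose (pairField dWaveFormFactor L) *
            pairField dWaveFormFactor L)).trace.re)
    {M L₁ : ℕ}
    (hM : ∀ U ∈ Set.Ioo U₁ U₂, ∀ (L : ℕ) [NeZero L], L₁ ≤ L → Even L →
      Module.finrank ℂ
        ↥(szSector (Λ := FermionTorus 2 L) (2 * ⌊(1 - δ) * (L : ℝ) ^ 2 / 2⌋₊) 0 ⊓
          Module.End.eigenspace (Matrix.toLin' (hubbardTorus 2 L 1 U))
            (((hubbardTorus 2 L 1 U).minEnergyOn
              (szSector (Λ := FermionTorus 2 L) (2 * ⌊(1 - δ) * (L : ℝ) ^ 2 / 2⌋₊) 0) : ℝ) : ℂ)) ≤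
        M) :
    ∃ U₁' U₂' c : ℝ, U₁ ≤ U₁' ∧ U₁' < U₂' ∧ U₂' ≤ U₂ ∧ 0 < c ∧
      ∃ L₀ : ℕ, ∀ U ∈ Set.Ioo U₁' U₂', ∀ (L : ℕ) [NeZero L], L₀ ≤ L → Even L →
        let N : ℕ := 2 * ⌊(1 - δ) * (L : ℝ) ^ 2 / 2⌋₊
        let H := hubbardTorus 2 L 1 U
        let S := szSector (Λ := FermionTorus 2 L) N 0
        let E₀ := S ⊓ Module.End.eigenspace (Matrix.toLin' H) ((H.minEnergyOn S : ℝ) : ℂ)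
        let P := projMatrix (E₀.map (Fock.toEuclidean (ι := Orb (FermionTorus 2 L)) :
          Fock (Orb (FermionTorus 2 L)) →ₗ[ℂ] EuclideanSpace ℂ (Finset (Orb (FermionTorus 2 L)))))
        c * (L : ℝ) ^ 4 * P.trace.re ≤
          (P * (Matrix.conjTranspose (pairField dWaveFormFactor L) *
            pairField dWaveFormFactor L)).trace.re := by
  classical
  obtain ⟨a, b, c, ha, hab, hb, hc, C, hC, L₀, hfl⟩ :=
    dWaveAvg_uniform_offCountable_of_pointwise hδ hU hpw
  refine ⟨a, b, c / ((max M 1 : ℕ) : ℝ), ha, hab, hb, by positivity, max L₀ L₁,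
    fun U hU' L _ hL hLe => ?_⟩
  intro N H S E₀ P
  have hLL₀ : L₀ ≤ L := le_of_max_le_left hL
  have hLL₁ : L₁ ≤ L := le_of_max_le_right hL
  have hUW : U ∈ Set.Ioo U₁ U₂ := ⟨lt_of_le_of_lt ha hU'.1, lt_of_lt_of_le hU'.2 hb⟩
  set D : Matrix (Finset (Orb (FermionTorus 2 L))) (Finset (Orb (FermionTorus 2 L))) ℂ :=
    ∑ x : FermionTorus 2 L, numberOp x 0 * numberOp x 1 with hD
  set B : Matrix (Finset (Orb (FermionTorus 2 L))) (Finset (Orb (FermionTorus 2 L))) ℂ :=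
    Matrix.conjTranspose (pairField dWaveFormFactor L) * pairField dWaveFormFactor L with hB
  -- the pencil `hubbardTorus 2 L 1 U = H(0) + U • D`, Hermitian, preserving `S ≠ ⊥`; `B ≥ 0`
  have hpen : ∀ u : ℝ, hubbardTorus 2 L 1 u = hubbardTorus 2 L 1 0 + (u : ℂ) • D := fun u =>
    hubbardTorus_eq_zero_add_smul_interaction u
  have hHh : ∀ u : ℝ, (hubbardTorus 2 L 1 u).IsHermitian := fun u =>
    hubbardTorus_isHermitian (hamiltonian_isHermitian_and_commute_holds (fermionTorusGraph 2 L))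
      1 u
  have hDeq : D = hubbardTorus 2 L 1 1 - hubbardTorus 2 L 1 0 := by
    rw [hpen 1, Complex.ofReal_one, one_smul, add_sub_cancel_left]
  have hDh : D.IsHermitian := by rw [hDeq]; exact (hHh 1).sub (hHh 0)
  have hSH : ∀ v ∈ S, hubbardTorus 2 L 1 0 *ᵥ v ∈ S := fun v hv =>
    hubbardTorus_mulVec_mem_szSector 1 0 hv
  have hSD : ∀ v ∈ S, D *ᵥ v ∈ S := fun v hv => by
    rw [hDeq, sub_mulVec]
    exact S.sub_mem (hubbardTorus_mulVec_mem_szSector 1 1 hv)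
      (hubbardTorus_mulVec_mem_szSector 1 0 hv)
  have hSU : ∀ v ∈ S, hubbardTorus 2 L 1 U *ᵥ v ∈ S := fun v hv =>
    hubbardTorus_mulVec_mem_szSector 1 U hv
  have hm : ⌊(1 - δ) * (L : ℝ) ^ 2 / 2⌋₊ ≤ Fintype.card (FermionTorus 2 L) := by
    have hcard : Fintype.card (FermionTorus 2 L) = L ^ 2 := by simp
    rw [hcard]
    apply Nat.floor_le_of_le
    have hL2 : (0 : ℝ) ≤ (L : ℝ) ^ 2 := by positivity
    push_cast
    nlinarith
  have hSne : S ≠ ⊥ := by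
    obtain ⟨⟨ψ, hψS, hψ0, -⟩, -⟩ := szSector_groundState (fermionTorusGraph 2 L) 1 0 hm
    exact fun h => hψ0 ((Submodule.eq_bot_iff _).1 h ψ hψS)
  have hBpsd : B.PosSemidef := Matrix.posSemidef_conjTranspose_mul_self _
  -- `Re tr P = dim E₀ ∈ [1, max M 1]`
  have htr : P.trace.re = Module.finrank ℂ E₀ := re_trace_projMatrix_map_eq_finrank _
  have hE₀ne : E₀ ≠ ⊥ := inf_eigenspace_minEnergyOn_ne_bot (hHh U) S hSU hSne
  have htr1 : 1 ≤ P.trace.re := by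
    rw [htr]
    exact Nat.one_le_cast.2 (Submodule.one_le_finrank_iff.mpr hE₀ne)
  have htrM : P.trace.re ≤ ((max M 1 : ℕ) : ℝ) := by
    rw [htr]
    exact_mod_cast (hM U hUW L hLL₁ hLe).trans (le_max_left M 1)
  -- the floor `c L⁴ ≤ Re tr (P B)` at `U`, whether or not `U` is exceptional for `L`
  have hfloorU : c * (L : ℝ) ^ 4 ≤ (P * B).trace.re := by
    by_cases hUC : U ∈ C L
    · -- `U` exceptional: a limit point of good couplings
      have hdense : Dense (C L)ᶜ := by
        rw [← interior_eq_empty_iff_dense_compl]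
        have h := (hC L).2.1
        rwa [IsNowhereDense, (hC L).1.closure_eq] at h
      have hcl : U ∈ closure (Set.Ioo a b ∩ (C L)ᶜ) :=
        hdense.open_subset_closure_inter isOpen_Ioo hU'
      refine le_re_trace_groundProj_mul_of_mem_closure (hHh 0) hDh hBpsd S hSH hSD hSne
        (A := fun u => hubbardTorus 2 L 1 u)
        (E := fun u => S ⊓ Module.End.eigenspace (Matrix.toLin' (hubbardTorus 2 L 1 u))
          (((hubbardTorus 2 L 1 u).minEnergyOn S : ℝ) : ℂ))
        (P := fun u => projMatrix ((S ⊓ Module.End.eigenspace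
          (Matrix.toLin' (hubbardTorus 2 L 1 u))
            (((hubbardTorus 2 L 1 u).minEnergyOn S : ℝ) : ℂ)).map
          (Fock.toEuclidean (ι := Orb (FermionTorus 2 L)) :
            Fock (Orb (FermionTorus 2 L)) →ₗ[ℂ]
              EuclideanSpace ℂ (Finset (Orb (FermionTorus 2 L))))))
        hpen (fun _ => rfl) (fun _ => rfl) hcl fun u hu => ?_
      have h : c * (L : ℝ) ^ 4 * (projMatrix ((S ⊓ Module.End.eigenspace
          (Matrix.toLin' (hubbardTorus 2 L 1 u))
            (((hubbardTorus 2 L 1 u).minEnergyOn S : ℝ) : ℂ)).map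
          (Fock.toEuclidean (ι := Orb (FermionTorus 2 L)) :
            Fock (Orb (FermionTorus 2 L)) →ₗ[ℂ]
              EuclideanSpace ℂ (Finset (Orb (FermionTorus 2 L)))))).trace.re ≤
          (projMatrix ((S ⊓ Module.End.eigenspace
          (Matrix.toLin' (hubbardTorus 2 L 1 u))
            (((hubbardTorus 2 L 1 u).minEnergyOn S : ℝ) : ℂ)).map
          (Fock.toEuclidean (ι := Orb (FermionTorus 2 L)) :
            Fock (Orb (FermionTorus 2 L)) →ₗ[ℂ]
              EuclideanSpace ℂ (Finset (Orb (FermionTorus 2 L))))) * B).trace.re :=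
        hfl u hu.1 L hLL₀ hLe hu.2
      exact h
    · have h : c * (L : ℝ) ^ 4 * P.trace.re ≤ (P * B).trace.re := hfl U hU' L hLL₀ hLe hUC
      have h1 : c * (L : ℝ) ^ 4 * 1 ≤ c * (L : ℝ) ^ 4 * P.trace.re :=
        mul_le_mul_of_nonneg_left htr1 (by positivity)
      linarith
  -- conclude with the constant `c / max M 1`
  have hmax : (1 : ℝ) ≤ ((max M 1 : ℕ) : ℝ) := by exact_mod_cast le_max_right M 1
  have hkey : c / ((max M 1 : ℕ) : ℝ) * (L : ℝ) ^ 4 * P.trace.re ≤ c * (L : ℝ) ^ 4 := by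
    rw [div_mul_eq_mul_div, div_mul_eq_mul_div, div_le_iff₀ (by positivity)]
    exact mul_le_mul_of_nonneg_left htrM (by positivity)
  exact hkey.trans hfloorU

end Torus

/-! ### The target from per-coupling order plus a uniform multiplicity bound -/

/-- **Pointwise floor + uniformly bounded ground multiplicity ⇒ `BirGroundStateAverageLRO`.**
If for some `δ ∈ (0,½)` and window `0 < U₁ < U₂` the target's inner inequality holds at every
coupling with its own constant, and the sector ground multiplets have dimension `≤ M` on the
window for all even `L ≥ L₁`, then the target holds as typed (on a sub-window, constant
`c / max(M,1)`). [folklore] -/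
theorem birGroundStateAverageLRO_of_pointwise_of_finrank_le
    (h : ∃ δ ∈ Set.Ioo (0:ℝ) (1/2), ∃ U₁ U₂ : ℝ, 0 < U₁ ∧ U₁ < U₂ ∧
      (∀ U ∈ Set.Ioo U₁ U₂, ∃ c : ℝ, 0 < c ∧ ∃ L₀ : ℕ, ∀ (L : ℕ) [NeZero L], L₀ ≤ L → Even L →
        let N : ℕ := 2 * ⌊(1 - δ) * (L : ℝ) ^ 2 / 2⌋₊
        let H := hubbardTorus 2 L 1 U
        let S := szSector (Λ := FermionTorus 2 L) N 0
        let E₀ := S ⊓ Module.End.eigenspace (Matrix.toLin' H) ((H.minEnergyOn S : ℝ) : ℂ)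
        let P := projMatrix (E₀.map (Fock.toEuclidean (ι := Orb (FermionTorus 2 L)) :
          Fock (Orb (FermionTorus 2 L)) →ₗ[ℂ] EuclideanSpace ℂ (Finset (Orb (FermionTorus 2 L)))))
        c * (L : ℝ) ^ 4 * P.trace.re ≤
          (P * (Matrix.conjTranspose (pairField dWaveFormFactor L) *
            pairField dWaveFormFactor L)).trace.re) ∧
      ∃ M L₁ : ℕ, ∀ U ∈ Set.Ioo U₁ U₂, ∀ (L : ℕ) [NeZero L], L₁ ≤ L → Even L →
        Module.finrank ℂ
          ↥(szSector (Λ := FermionTorus 2 L) (2 * ⌊(1 - δ) * (L : ℝ) ^ 2 / 2⌋₊) 0 ⊓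
            Module.End.eigenspace (Matrix.toLin' (hubbardTorus 2 L 1 U))
              (((hubbardTorus 2 L 1 U).minEnergyOn
                (szSector (Λ := FermionTorus 2 L) (2 * ⌊(1 - δ) * (L : ℝ) ^ 2 / 2⌋₊) 0) : ℝ) : ℂ)) ≤
          M) :
    BirGroundStateAverageLRO := by
  obtain ⟨δ, hδ, U₁, U₂, hU₁, hU, hpw, M, L₁, hM⟩ := h
  obtain ⟨a, b, c, ha, hab, _, hc, L₀, hfl⟩ :=
    dWaveAvg_uniform_of_pointwise_of_finrank_le (by linarith [hδ.1]) hU hpw hM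
  unfold BirGroundStateAverageLRO
  exact ⟨δ, hδ, a, b, c, by linarith, hab, hc, fun U hU' => ⟨L₀, fun L _ hL hLe =>
    hfl U hU' L hL hLe⟩⟩

/-- **Per-coupling summit-strength pair LRO on a window + uniformly bounded ground multiplicity ⇒
`BirGroundStateAverageLRO`.** If `HasDWavePairFieldLROAt U δ` (every sequence of normalised
sector ground states has `d_{x²-y²}` pair-field LRO) holds at EVERY coupling of a window
`0 < U₁ < U₂` with `δ ∈ (0,½)`, and the sector ground multiplets have dimension `≤ M` on the
window for all even `L ≥ L₁`, then the route target holds as typed. Compare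
`birGroundStateAverageLRO_coCountable_of_forall_hasDWavePairFieldLROAt` (no multiplicity
hypothesis, conclusion only off a countable set of couplings) and
`BirGroundStateAverageLRO.Negative.exists_affinePencil_pointwiseFloor_not_uniformAverage`
(without a multiplicity bound the exceptional set is unavoidable for affine pencils). [folklore] -/
theorem birGroundStateAverageLRO_of_forall_hasDWavePairFieldLROAt_of_finrank_le {δ U₁ U₂ : ℝ}
    (hδ : δ ∈ Set.Ioo (0:ℝ) (1/2)) (hU₁ : 0 < U₁) (hU : U₁ < U₂)
    (h : ∀ U ∈ Set.Ioo U₁ U₂, HasDWavePairFieldLROAt U δ)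
    {M L₁ : ℕ}
    (hM : ∀ U ∈ Set.Ioo U₁ U₂, ∀ (L : ℕ) [NeZero L], L₁ ≤ L → Even L →
      Module.finrank ℂ
        ↥(szSector (Λ := FermionTorus 2 L) (2 * ⌊(1 - δ) * (L : ℝ) ^ 2 / 2⌋₊) 0 ⊓
          Module.End.eigenspace (Matrix.toLin' (hubbardTorus 2 L 1 U))
            (((hubbardTorus 2 L 1 U).minEnergyOn
              (szSector (Λ := FermionTorus 2 L) (2 * ⌊(1 - δ) * (L : ℝ) ^ 2 / 2⌋₊) 0) : ℝ) : ℂ)) ≤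
        M) :
    BirGroundStateAverageLRO := by
  have hδ1 : -1 ≤ δ := by linarith [hδ.1]
  refine birGroundStateAverageLRO_of_pointwise_of_finrank_le
    ⟨δ, hδ, U₁, U₂, hU₁, hU, fun U hUW => ?_, M, L₁, hM⟩
  obtain ⟨c, hc, L₀, hL₀⟩ := (forall_hasLRO_iff_groundState_bound U δ hδ1).mp (h U hUW)
  refine ⟨c, hc, L₀, fun L _ hL hLe => ?_⟩
  intro N H S E₀ P
  refine re_trace_projMatrix_map_mul_ge_of_forall_unit E₀ _ (c * (L : ℝ) ^ 4) fun ψ hψ hunit => ?_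
  obtain ⟨hψS, hψE⟩ := Submodule.mem_inf.mp hψ
  rw [Module.End.mem_eigenspace_iff, Matrix.toLin'_apply] at hψE
  have hψ0 : ψ ≠ 0 := by
    rintro rfl
    simp at hunit
  exact hL₀ L hL hLe ψ ⟨hψS, hψ0, hψE⟩ hunit

end Summit.HubbardSuperconductivity.HubbardSuperconductivity.Theorems
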